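import Literature.IUT.HodgeTheaters.InitialThetaDataLocalGroups
import Literature.IUT.HodgeTheaters.InitialThetaDataLocalGalois
import HarnessLib

/-!
# [IUTchI] Def. 3.1 (e), (f): `Π_{(−)_v̲} ↪ Π_{(−)}` — the base-changed groups are decomposition subgroups (proofs)

`Proofs` companion (theorems only; no definitions, no instances) of `InitialThetaDataLocalGroups.lean` and
`InitialThetaDataLocalGalois.lean` (abc-iut-L5-t2). S. Mochizuki, *Inter-universal Teichmüller theory I*,
Def. 3.1 (e), (f) (kurims May-2020 manuscript pp. 62–63) [claim: Mochizuki2012, status: disputed]: "natural cartesian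
diagrams … and corresponding injections of profinite groups … for `v ∈ V̲^good`, `Π_{X̲→_v} ⊆ Π_{C̲→_v} ⊆ Π_{C_v}`".
For `D : InitialThetaData F K Fbar E l P`, a subgroup `H = Π_{(−)} ⊆ Π_{C_F}` and `ρ : Γ →* G_F`:
* `fstLoc_injective` — if `ρ` is injective then the first projection `Π_{(−)_v̲} = Π_{(−)} ×_{G_F} Γ → Π_{(−)}` is
  injective, and (`nonempty_mulEquiv_PiLoc_inf`) **`Π_{(−)_v̲} ≅ Π_{(−)} ∩ augGF⁻¹(ρ(Γ))`**, the decomposition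
  subgroup of `Π_{(−)}` over `ρ(Γ)`;
  (at a finite place `w` of `K`, where `ρ := localToGF F K_w ι` IS injective — `localToGF_injective_adicCompletion` of
  `InitialThetaDataLocalGaloisProofs.lean` — this says that print's `Π_v̲ := Π_{X̲→_v̲}` IS the decomposition subgroup
  `Π_{X̲→_K} ×_{G_K} G_v̲ ⊆ Π_{X̲→_K}`: sibling `InitialThetaDataLocalGroupsPlaceProofs.lean`);
* the `F`-level groups of (e) for `v ∈ V(F)` ("the subscript `v` denotes base-change with respect to `F ↪ F_v`"):
  `Π_{X_v} := Π_{X_F} ×_{G_F} Gal(F̄_v/F_v)` and `Π_{C_v}` (`H = Π_{X_F}`, `⊤`; `ρ = localToGlobal F_v ι`) surject onto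
  `Gal(F̄_v/F_v)` by OPEN maps with NO extra hypothesis (`Π_{X_F}` is open: field `PiX_isOpen` of `ThetaGeometry`):
  `augLoc_PiX_surjective`, `isOpenMap_augLoc_PiX`, `augLoc_top_surjective`, `isOpenMap_augLoc_top`.
Nothing of the disputed series is asserted; no side is taken.
-/

noncomputable section

namespace Literature.IUT.HodgeTheaters

universe u v w w'

namespace InitialThetaData

section Generic

variable {F : Type u} {K : Type v} {Fbar : Type w} [Field F] [NumberField F] [Field K] [NumberField K]
  [Algebra F K] [Field Fbar] [Algebra F Fbar] [Algebra K Fbar]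
  {E : WeierstrassCurve F} [E.IsElliptic] {l : ℕ} {Pb : BadPlacePredicates K}
  (D : InitialThetaData F K Fbar E l Pb) (H : Subgroup D.PiC)
  {Γ : Type w'} [Group Γ] (ρ : Γ →* (Fbar ≃ₐ[F] Fbar))

/-- **`Π_{(−)_v̲} → Π_{(−)}` is injective when `ρ : Γ → G_F` is** (the `Γ`-component of `(x, σ) ∈ Π_{(−)} ×_{G_F} Γ`
is recovered from `augGF x = ρ σ`). [claim: Mochizuki2012, status: disputed] -/
theorem fstLoc_injective (hρ : Function.Injective ρ) : Function.Injective (D.fstLoc H ρ) := by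
  intro z z' h
  have h1 : z.1.1 = z'.1.1 := h
  have hz := ((D.mem_PiLoc H ρ z.1).mp z.2).2
  have hz' := ((D.mem_PiLoc H ρ z'.1).mp z'.2).2
  rw [h1, hz'] at hz
  exact Subtype.ext (Prod.ext h1 (hρ hz.symm))

/-- **`Π_{(−)_v̲} ≅ Π_{(−)} ∩ augGF⁻¹(ρ(Γ))`** when `ρ` is injective: the base-changed group is the decomposition
subgroup of `Π_{(−)}` over `ρ(Γ) ⊆ G_F` (`range_fstLoc`). [claim: Mochizuki2012, status: disputed] -/
theorem nonempty_mulEquiv_PiLoc_inf (hρ : Function.Injective ρ) :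
    Nonempty (D.PiLoc H ρ ≃* (H ⊓ ρ.range.comap D.augGF : Subgroup D.PiC)) :=
  ⟨(MonoidHom.ofInjective (D.fstLoc_injective H ρ hρ)).trans (MulEquiv.subgroupCongr (D.range_fstLoc H ρ))⟩

include D in
/-- `F̄` is algebraically closed (it is an algebraic closure of `F`): the instance hypothesis `[IsAlgClosed Fbar]`
of the place-level statements, discharged from the datum. [claim: Mochizuki2012, status: disputed] -/
theorem isAlgClosed : IsAlgClosed Fbar := by
  haveI := D.isAlgClosure
  exact IsAlgClosure.isAlgClosed F

end Generic


/-! ### The `F`-level groups of Def. 3.1 (e): `Π_{X_v}`, `Π_{C_v}` for `v ∈ V(F)` (no openness hypothesis) -/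

section FLevel

variable {F : Type u} {K : Type v} {Fbar : Type w} [Field F] [NumberField F] [Field K] [NumberField K]
  [Algebra F K] [Field Fbar] [Algebra F Fbar] [Algebra K Fbar] [Normal F Fbar]
  {E : WeierstrassCurve F} [E.IsElliptic] {l : ℕ} {Pb : BadPlacePredicates K}
  (D : InitialThetaData F K Fbar E l Pb)
  {Ω : Type w'} [Field Ω] [Algebra F Ω] (k : Type w') [Field k] [Algebra F k] [Algebra k Ω] [IsScalarTower F k Ω]
  (ι : Fbar →ₐ[F] Ω)

omit [Normal F Fbar] in
include D in
/-- `F̄/F` is normal (`F̄` is an algebraic closure of `F`): the instance hypothesis `[Normal F Fbar]` of this section,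
discharged from the datum. [claim: Mochizuki2012, status: disputed] -/
theorem normal_F : Normal F Fbar := by
  haveI := D.isAlgClosure
  exact IsAlgClosure.normal F Fbar

/-- **`Π_{X_v} ↠ Gal(Ω/k)` is surjective** for the base change `Π_{X_v} := Π_{X_F} ×_{G_F} Gal(Ω/k)` along
`F ↪ k = F_v` (Def. 3.1 (e), `v ∈ V(F)`; `ρ = localToGlobal k ι : Gal(Ω/k) → G_F`): from `Π_{X_F} ↠ G_F`
(`map_augGF_PiX`). [claim: Mochizuki2012, status: disputed] -/
theorem augLoc_PiX_surjective : Function.Surjective (D.augLoc D.geom.PiX (localToGlobal k ι)) :=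
  D.augLoc_surjective D.geom.PiX (localToGlobal k ι) (by rw [D.map_augGF_PiX]; exact le_top)

/-- **`Π_{X_v} ↠ Gal(Ω/k)` is open** — unconditionally: `Π_{X_F} ⊆ Π_{C_F}` is open (field `PiX_isOpen` of
`ThetaGeometry`, Def. 3.1 (b)) and the restriction `Gal(Ω/k) → G_F` is Krull-continuous.
[claim: Mochizuki2012, status: disputed] -/
theorem isOpenMap_augLoc_PiX : IsOpenMap (D.augLoc D.geom.PiX (localToGlobal k ι)) :=
  D.isOpenMap_augLoc D.geom.PiX (localToGlobal k ι) D.geom.PiX_isOpen (continuous_localToGlobal k ι)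

/-- **`Π_{C_v} ↠ Gal(Ω/k)` is surjective** for `Π_{C_v} := Π_{C_F} ×_{G_F} Gal(Ω/k)` (`H = ⊤`), from `Π_{C_F} ↠ G_F`.
[claim: Mochizuki2012, status: disputed] -/
theorem augLoc_top_surjective : Function.Surjective (D.augLoc ⊤ (localToGlobal k ι)) :=
  D.augLoc_surjective ⊤ (localToGlobal k ι)
    (by rw [← MonoidHom.range_eq_map, MonoidHom.range_eq_top.mpr D.augGF_surjective]; exact le_top)

/-- **`Π_{C_v} ↠ Gal(Ω/k)` is open** (`Π_{C_F}` is open in itself). [claim: Mochizuki2012, status: disputed] -/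
theorem isOpenMap_augLoc_top : IsOpenMap (D.augLoc ⊤ (localToGlobal k ι)) :=
  D.isOpenMap_augLoc ⊤ (localToGlobal k ι) (by simp) (continuous_localToGlobal k ι)

end FLevel

end InitialThetaData

end Literature.IUT.HodgeTheaters

end
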